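import Mathlib
import HarnessLib
import HarnessLib.Audit
import Summits.Langlands.Statement
import Summits.Langlands.Langlands.Theorems.SplitPrimeDescentLadder
import Summits.Langlands.Langlands.Theorems.SplitPrimeDescentLadderResidual
import Summits.Langlands.Langlands.Theorems.SplitPrimeDescentLadderTwistModelPrelude
import Summits.Langlands.Langlands.Theorems.SplitPrimeDescentLadderTwistModel
import Summits.Langlands.Langlands.Theorems.SplitPrimeDescentLadderFieldSupply
import Literature.NumberTheory.GaloisRepresentations.ArtinReciprocityCharacterProofs
import Literature.NumberTheory.GaloisRepresentations.AbsGaloisOuterConj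
import Literature.NumberTheory.GaloisRepresentations.ArtinRestriction
import Literature.NumberTheory.Automorphic.StrongArtinGL2
import Literature.NumberTheory.Automorphic.ReciprocityGLnPatchingFamily
import Literature.NumberTheory.Automorphic.ReciprocityGLnPatchingGalois
import Literature.NumberTheory.GaloisRepresentations.SGeneralQuadraticFamily
import Summits.Langlands.Langlands.Theorems.SplitPrimeDescentLadderDyadic
import Summits.Langlands.Langlands.Theorems.SplitPrimeDescentLadderDyadicTwistModelPrelude

/-!
# CENSUS TWIN (ii)-b of lens-1 g36's D₂ birth — T1₂ `fieldSupplyTwo(_quadratic)`, T2₂ `twistModelTwo_holds`, assemblies `CofinalResidualDoorTwo_of(_quadraticDoor)`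

Sorry-free extraction per RUNME §6: the stub `stub_rmDoorTwo` and the closing `CofinalResidualDoorTwo_proof` are REMOVED (they stay in the
HOME birth file), the local copy of the crux is replaced by the tree decl `…Theorems.SplitPrimeDescentLadder.CofinalResidualDoorTwo` (p835035),
clause defs + PreludeTwo live in `…DyadicTwistModelPrelude.lean`. The birth's own module docstring follows verbatim FOR RECORD (its mentions of
`stub_rmDoorTwo` / sorries describe the birth, not this file).
-/


/-! # BC3 birth skeleton for D₂ `SplitPrimeDescentLadder.CofinalResidualDoorTwo` (decomp-langlands, lens-1 «grading /
quantitative ladder», generation 36; node `SplitPrimeDescentLadder` **v4** = kit `decomp-langlands-lens-1/g36/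
SplitPrimeDescentLadderDyadic.lean` — NOT YET IN THE TREE.  Until census lands v4 this file carries the crux text
VERBATIM as the local `def CofinalResidualDoorTwo` and concludes THAT decl by name; afterbirth = replace the local def by
the tree decl (`theorem _iff_tree : CofinalResidualDoorTwo ↔ Summit.…SplitPrimeDescentLadder.CofinalResidualDoorTwo :=
Iff.rfl`) once it exists.)

D₂ = the v3 door D∞' at the RESIDUAL PRIME `2`: for an irreducible even icosahedral `σ` that is `2`-GOOD (unramified
at `2`, projective `Frob₂` of order `3` or `5`, i.e. `t ≠ 0 ∧ t² ≠ 4d`), for all but finitely many `p`: a CM cyclic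
member field `M` (squarefree degree, window, `p` split, `√-d ∈ M` with `d ≡ 7 (mod 8)` so that `2` splits), a twist
`τ = χ ⊗ σ|_M` with a finite-image `2`-adic model `τ₂` (unramified above `p`, projectively `A₅`, unramified and
`2`-adically distinguished above `2`), and residual automorphy of `τ₂` in the completed cohomology of `GL₂/M` at
`p = 2` (`TameLevel 2 M 2`, non-Eisenstein `𝔪`, `ρ̄_𝔪` a reduction of `τ₂`; any weight, torsion allowed).
THREE-WAY SPLIT along the layers of the statement, as for D∞' (g34/g35), through the QUADRATIC door:

* `fieldSupplyTwo_quadratic` (T1₂, **PROVED here**): for every `p` the imaginary quadratic field `ℚ(√-(16 p₀ - 1))`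
  satisfies the field clauses, has `2` split, and has degree `2` (clone of the landed T1 `fieldSupply_holds`,
  `24 ↦ 16`; the tree lemma `ncard_primesOver_sqrtNegField_eq_two` covers `q = 2`).
* `twistModelTwo_holds` (T2₂, **PROVED here**): clone of the landed T2 `twistModel_holds` with `χ = 1`,
  `τ₂ = ι⁻¹ ∘ σ|_M`; the one new ingredient is `‖a - b‖₂ = 1` for the Frobenius eigenvalues above `2`, which needs
  the eigenvalue ratio to avoid order `1, 2` (hypotheses `t² ≠ 4d`, `t ≠ 0`) AND order `4` — excluded because `A₅`
  has exponent `30` (`alternatingGroup_five_pow_thirty`, via cycle types; at `p = 3` the landed proof only needed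
  `ζ ^ 60 = 1`).
* `stub_rmDoorTwo` (RM₂, ATTACKABLE — the DOOR at `r = 2` through the quadratic members: «a finite-image projectively
  icosahedral `2`-adic representation of `Γ_M`, `M` imaginary quadratic with `2` split, unramified with `2`-adically
  distinct Frobenius eigenvalues above `2`, is residually automorphic in `H̃•(GL₂/M)` at `p = 2` at some tame level».
  PRINT CHAIN: `τ̄₂ : Γ_M → SL₂(F₄) ≅ A₅` (no twist: `ω₂ = 1`) is `A[2]` for a principally polarised abelian surface
  `A/M` with RM by `ℤ[(1+√5)/2]` (Shepherd-Barron–Taylor 1997, moduli = twisted Hilbert modular surface, rational;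
  Taylor PJM 181 (1997) p. 344 — printed over `ℚ`, fine print (i): run it over `M`), `A[√5] : Γ_M → GL₂(F₅)` surjective
  by Hilbert irreducibility with cyclotomic determinant (Weil pairing); `ζ₅ ∉ M`, `√5 ∉ M` automatic for imaginary
  quadratic `M`; AKT arXiv:1910.12986 Prop 9.12 (p. 61): soluble CM `L/M`, modular elliptic curve `E/L` with
  `ρ̄_{E,5} ≅ A[√5]|_L`, Tate above `5`; AKT Thm 8.1 (p. 56) at the odd prime `5` over `L` for `ρ_{A,√5}|_L` (fine print
  (ii): `A` ordinary above `5` — a weak-approximation condition on the rational family; (iii): decomposed genericity)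
  ⟹ `A_L` automorphic; soluble descent `L → M` of the weight-`0` regular-algebraic cuspidal system of `A` (cyclic
  base change + multiplicity one, as in AKT Cor 9.13); bookkeeping: cohomological cuspidal `π_A` on `GL₂/M` ⟹
  non-Eisenstein `𝔪 ⊂ 𝕋(U^2)` with `ρ̄_𝔪 ≅ A[𝔩]`, `𝔩 = (2)` inert in `ℤ[(1+√5)/2]`, `A[𝔩] ≅ τ̄₂`.  Why it might fail:
  (i)–(iii) are genuine fine print; the chain is five theorems long and none of its links is typed in the tree.

`CofinalResidualDoorTwo_of : T1₂ → T2₂ → RM₂ → CofinalResidualDoorTwo` (general-member version) and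
`CofinalResidualDoorTwo_of_quadraticDoor : T2₂ → RM₂(quadratic) → CofinalResidualDoorTwo` are PROVED (bookkeeping:
a.e. unramifiedness of `σ` + re-tupling); `CofinalResidualDoorTwo_proof` concludes the crux BY NAME from the ONE
remaining stub RM₂.  So **D₂ ⟸ RM₂ (ATTACKABLE print chain)** — compare v3: D∞' ⟸ T3 (IDEA-NEEDED).
`lean check`: rc 0 · sorries = 1 = `stub_rmDoorTwo` · 0 elsewhere.
-/

set_option linter.dupNamespace false -- project-wide option; `Summit.Langlands.Langlands` is the mandated namespace

noncomputable section

namespace Summit.Langlands.Langlands.Theorems.SplitPrimeDescentLadder.V4Birth.CofinalResidualDoorTwo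

open scoped MatrixGroups NumberField
open NumberField IsDedekindDomain Filter Polynomial
open Literature.NumberTheory.GaloisRepresentations Literature.NumberTheory.Automorphic
open Literature.NumberTheory.GaloisRepresentations.QuadraticFamily
open Summit.Langlands.Langlands.Theorems.SplitPrimeDescentLadder.V3Birth.CofinalResidualDoor


/-! ## T1₂ — field supply at `2`, PROVED (quadratic members `ℚ(√-(16 p₀ - 1))`) -/

/-- **T1₂ (quadratic form) PROVED.**  For every finite place `p` of `ℚ` the imaginary quadratic field `ℚ(√-D)`,
`D + 1 = 16 p₀`, satisfies `FieldClausesTwo p`, has `2` split and degree `2`. [folklore: decomposition law in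
quadratic fields; tree `sqrtNegField`, `ncard_primesOver_sqrtNegField_eq_two`] -/
theorem fieldSupplyTwo_quadratic :
    ∀ p : IsDedekindDomain.HeightOneSpectrum (NumberField.RingOfIntegers ℚ), ∃ (M : Type) (_ : Field M) (_ : NumberField M), FieldClausesTwo p M ∧ TwoSplit M ∧ Module.finrank ℚ M = 2 := by
  intro p
  obtain ⟨p₀, hp₀, hp₀v⟩ := exists_prime_natCast_mem p
  have hp2 : 2 ≤ p₀ := hp₀.two_le
  obtain ⟨D, hD1⟩ : ∃ D : ℕ, D + 1 = 16 * p₀ := ⟨16 * p₀ - 1, by omega⟩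
  have hDpos : 0 < D := by omega
  have hD8 : D % 8 = 7 := by omega
  haveI : Fact (¬ IsSquare (-(D : ℚ))) := ⟨Summit.Langlands.Langlands.Theorems.IcosahedralQuadraticDescent.not_isSquare_neg_natCast hDpos⟩
  haveI : Algebra.IsQuadraticExtension ℚ (sqrtNegField ℚ D) := ⟨finrank_sqrtNegField⟩
  haveI hG : IsGalois ℚ (sqrtNegField ℚ D) := inferInstance
  refine ⟨sqrtNegField ℚ D, inferInstance, inferInstance, ⟨?_, hG, ?_, ?_, ?_, ?_, ?_⟩, ?_, finrank_sqrtNegField⟩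
  · exact Literature.NumberTheory.Automorphic.PatchingFamily.isCMField_sqrtNegField (K := ℚ) (D := D)
      (Or.inl inferInstance) hDpos.ne'
  · haveI : Fact (Nat.Prime 2) := ⟨Nat.prime_two⟩
    have hcard : Nat.card (sqrtNegField ℚ D ≃ₐ[ℚ] sqrtNegField ℚ D) = 2 := by
      rw [IsGalois.card_aut_eq_finrank, finrank_sqrtNegField]
    exact isCyclic_of_prime_card hcard
  · rw [finrank_sqrtNegField]
    exact Nat.prime_two.prime.squarefree
  · intro ℓ hℓ hdvd
    rw [finrank_sqrtNegField] at hdvd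
    exact Or.inl ((Nat.prime_dvd_prime_iff_eq hℓ Nat.prime_two).mp hdvd)
  · intro w hw
    exact inertiaDeg_ramificationIdx_eq_one_of_dvd hp₀ p hp₀v (by rw [hD1]; exact ⟨2, by ring⟩) w hw
  · refine ⟨D, QuadraticAlgebra.omega, hD8, ?_⟩
    rw [omega_sq, map_neg, map_natCast, neg_add_cancel]
  · intro w h2
    haveI := w.isPrime
    have hmem : (2 : 𝓞 ℚ) ∈ w.asIdeal.under (𝓞 ℚ) := by
      rw [Ideal.under_def, Ideal.mem_comap, map_ofNat]
      exact h2
    have hne : w.asIdeal.under (𝓞 ℚ) ≠ ⊥ := by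
      intro h
      rw [h, Ideal.mem_bot] at hmem
      exact (by exact_mod_cast (by norm_num : (2 : ℕ) ≠ 0) : (2 : NumberField.RingOfIntegers ℚ) ≠ 0) hmem
    let v : HeightOneSpectrum (𝓞 ℚ) := ⟨w.asIdeal.under (𝓞 ℚ), inferInstance, hne⟩
    have hv : ((2 : ℕ) : 𝓞 ℚ) ∈ v.asIdeal := by
      rw [Nat.cast_ofNat]
      exact hmem
    exact inertiaDeg_ramificationIdx_eq_one_of_dvd Nat.prime_two v hv (by rw [hD1]; exact ⟨p₀, by ring⟩) w rfl

/-- **T1₂ `fieldSupplyTwo` PROVED** (general-member form, from the quadratic one). [folklore] -/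
theorem fieldSupplyTwo :
    ∀ p : IsDedekindDomain.HeightOneSpectrum (NumberField.RingOfIntegers ℚ), ∃ (M : Type) (_ : Field M) (_ : NumberField M), FieldClausesTwo p M ∧ TwoSplit M := fun p ↦ by
  obtain ⟨M, iF, iNF, hF, h2s, _⟩ := fieldSupplyTwo_quadratic p
  exact ⟨M, iF, iNF, hF, h2s⟩

/-! ## T2₂ — the twist model at `2`, PROVED -/

/-- **T2₂ `twistModelTwo_holds` PROVED** — GALOIS LAYER at `2`, uniform in `M`: `χ = 1`, `τ = σ|_M`,
`τ₂ = ι⁻¹ ∘ σ|_M` (clone of the landed `twistModel_holds`).  Finite image and unramifiedness are transported along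
`GL₂(ι⁻¹)`; the projective image of `σ|_M` is still `A₅` (`⁅Γ_ℚ, Γ_ℚ⁆ ≤ Γ_M` for `M/ℚ` cyclic, `A₅` perfect); at
`w ∣ 2` (split, `f = 1`) the Frobenius polynomial restricts unchanged, and `‖t² - 4d‖₂ = ‖a - b‖₂² = 1` because the
eigenvalue ratio `ζ = a/b` satisfies `ζ ^ 30 = 1` (projective order divides the EXPONENT `30` of `A₅` —
`alternatingGroup_five_pow_thirty`; `ζ ^ 60 = 1` would not do at `2`), `ζ ≠ 1` (`t² ≠ 4d`) and `ζ ≠ -1` (`t ≠ 0`).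
[DeligneSerre1974 §8; folklore] -/
theorem twistModelTwo_holds :
    ∀ (ι : PadicAlgCl 2 ≃+* ℂ) (σ : Literature.NumberTheory.GaloisRepresentations.FramedGaloisRep ℚ ℂ 2), Nonempty ((Matrix.ProjGenLinGroup.mk.comp σ.toMonoidHom).range ≃* alternatingGroup (Fin 5)) → (∀ v : IsDedekindDomain.HeightOneSpectrum (NumberField.RingOfIntegers ℚ), (2 : NumberField.RingOfIntegers ℚ) ∈ v.asIdeal → σ.IsUnramifiedAt v ∧ ∃ t d : ℂ, σ.HasFrobCharpolyAt v (Polynomial.X ^ 2 - Polynomial.C t * Polynomial.X + Polynomial.C d) ∧ t ≠ 0 ∧ t ^ 2 ≠ 4 * d) → ∀ p : IsDedekindDomain.HeightOneSpectrum (NumberField.RingOfIntegers ℚ), σ.IsUnramifiedAt p → ∀ (M : Type) [Field M] [NumberField M], FieldClausesTwo p M → TwoSplit M → ∃ (χ : Literature.NumberTheory.GaloisRepresentations.FramedGaloisRep M ℂ 1) (τ : Literature.NumberTheory.GaloisRepresentations.FramedGaloisRep M ℂ 2) (τ₂ : Literature.NumberTheory.GaloisRepresentations.FramedGaloisRep M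 (PadicAlgCl 2) 2), GaloisClausesTwo ι σ p M χ τ τ₂ := by
  intro ι σ hA5 h2g p hσp M _ _ hFC h2split
  classical
  obtain ⟨e⟩ := hA5
  haveI : IsGalois ℚ M := hFC.2.1
  haveI : IsCyclic (M ≃ₐ[ℚ] M) := hFC.2.2.1
  -- the coefficient isomorphism `ℂ → ar ℚ₃`
  set φ : ℂ →+* PadicAlgCl 2 := (ι.symm : ℂ ≃+* PadicAlgCl 2).toRingHom with hφ
  have hφapp : ∀ x, φ x = ι.symm x := fun x => rfl
  have hιφ : ∀ x, ι (φ x) = x := fun x => by rw [hφapp]; exact ι.apply_symm_apply x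
  -- the 2-adic model of `σ|_M`
  have hopen : IsOpen (((FramedGaloisRep.restrictField M σ : FramedGaloisRep M ℂ 2) :
      Field.absoluteGaloisGroup M →* GL (Fin 2) ℂ).ker : Set (Field.absoluteGaloisGroup M)) :=
    FramedArtinRep.isOpen_ker_toMonoidHom (K := M) (n := 2) (FramedGaloisRep.restrictField M σ)
  obtain ⟨τ₃, hτ₃⟩ := exists_map_of_isOpen_ker' (FramedGaloisRep.restrictField M σ) hopen φ
  -- census inline (G40 hygiene): the two coefficient-transport one-liners of
  -- `Literature…ArtinRepCoefficientTransport` (module unbuilt on the farm; `dedup.landed` forbids local decl copies)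
  have hunr_map : ∀ {v}, (FramedGaloisRep.restrictField M σ).IsUnramifiedAt v → τ₃.IsUnramifiedAt v :=
    fun h 𝔓 h𝔓 g hg => by rw [hτ₃ g, h 𝔓 h𝔓 g hg, map_one]
  have hchar_map : ∀ {v} {P : Polynomial ℂ}, (FramedGaloisRep.restrictField M σ).HasFrobCharpolyAt v P →
      τ₃.HasFrobCharpolyAt v (P.map φ) := by
    intro v P h 𝔓 h𝔓 g hg
    have e := h 𝔓 h𝔓 g hg
    unfold FramedRep.charpoly at e ⊢
    have hmat : ((τ₃ g : GL (Fin 2) (PadicAlgCl 2)) : Matrix (Fin 2) (Fin 2) (PadicAlgCl 2)) =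
        (((FramedGaloisRep.restrictField M σ) g : GL (Fin 2) ℂ) : Matrix (Fin 2) (Fin 2) ℂ).map φ := by
      ext i j
      rw [hτ₃ g, Matrix.GeneralLinearGroup.map_apply, Matrix.map_apply]
    rw [hmat, Matrix.charpoly_map, e]
  refine ⟨1, FramedGaloisRep.restrictField M σ, τ₃, ?_⟩
  unfold GaloisClausesTwo
  refine ⟨?_, ?_, ?_, ?_, ?_, ?_⟩
  · -- (G1) `τ = det(χ) • σ|_M` with `χ = 1`
    intro g
    simp only [ContinuousMonoidHom.coe_one, Pi.one_apply, map_one, Units.val_one, one_smul]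
  · -- (G2) `τ₃` is an `ι`-model of `τ`
    intro g
    ext i j
    rw [Matrix.map_apply, hτ₃ g, Matrix.GeneralLinearGroup.map_apply, hιφ]
  · -- (G3) finite image
    haveI : Finite (FramedGaloisRep.restrictField M σ).toMonoidHom.range :=
      finite_range_toMonoidHom (F := M) (n := 2) (FramedGaloisRep.restrictField M σ)
    refine Finite.of_surjective
      (fun x : (FramedGaloisRep.restrictField M σ).toMonoidHom.range =>
        (⟨Matrix.GeneralLinearGroup.map φ x.1, by
          obtain ⟨g, hg⟩ := MonoidHom.mem_range.1 x.2
          exact MonoidHom.mem_range.2 ⟨g, by rw [← hg]; exact hτ₃ g⟩⟩ : τ₃.toMonoidHom.range)) ?_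
    rintro ⟨y, hy⟩
    obtain ⟨g, rfl⟩ := MonoidHom.mem_range.1 hy
    exact ⟨⟨FramedGaloisRep.restrictField M σ g, MonoidHom.mem_range.2 ⟨g, rfl⟩⟩, Subtype.ext (hτ₃ g).symm⟩
  · -- (G4) unramified above `p`
    intro w hw
    exact ⟨fun _ _ _ _ => rfl,
      hunr_map (FramedGaloisRep.isUnramifiedAt_restrictField σ hw hσp)⟩
  · -- (G5) projective image still `A₅`
    have hτmh : (Matrix.ProjGenLinGroup.mk.comp (FramedGaloisRep.restrictField M σ).toMonoidHom) =
        (Matrix.ProjGenLinGroup.mk.comp σ.toMonoidHom).comp (absGaloisRestrict ℚ M).toMonoidHom := by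
      ext g; rfl
    have hrange : (Matrix.ProjGenLinGroup.mk.comp (FramedGaloisRep.restrictField M σ).toMonoidHom).range =
        (Matrix.ProjGenLinGroup.mk.comp σ.toMonoidHom).range := by
      rw [hτmh, MonoidHom.range_comp]
      exact map_eq_range_of_commutator_le _ _ (commutator_le_range_absGaloisRestrict ℚ M) e
    have hτ₃mh : (Matrix.ProjGenLinGroup.mk.comp τ₃.toMonoidHom) =
        (Matrix.ProjGenLinGroup.map φ).comp
          (Matrix.ProjGenLinGroup.mk.comp (FramedGaloisRep.restrictField M σ).toMonoidHom) := by
      ext g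
      simp only [MonoidHom.comp_apply, Matrix.ProjGenLinGroup.map_mk]
      exact congrArg Matrix.ProjGenLinGroup.mk (hτ₃ g)
    have hcomp : ((ι : PadicAlgCl 2 ≃+* ℂ).toRingHom.comp φ) = RingHom.id ℂ := by
      ext x; exact hιφ x
    have hinj : Function.Injective (Matrix.ProjGenLinGroup.map (n := Fin 2) φ) := by
      intro x y hxy
      have h' := congrArg (Matrix.ProjGenLinGroup.map (n := Fin 2) (ι : PadicAlgCl 2 ≃+* ℂ).toRingHom) hxy
      simp only [← MonoidHom.comp_apply, ← Matrix.ProjGenLinGroup.map_comp, hcomp,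
        Matrix.ProjGenLinGroup.map_id, MonoidHom.id_apply] at h'
      exact h'
    rw [hτ₃mh, MonoidHom.range_comp, hrange]
    exact ⟨((Matrix.ProjGenLinGroup.mk.comp σ.toMonoidHom).range.equivMapOfInjective _ hinj).symm.trans e⟩
  · -- (G6) unramified and `2`-adically distinguished above `2`
    intro w hw3
    have hw : w.asIdeal.under (𝓞 ℚ) = (w.under (𝓞 ℚ)).asIdeal := rfl
    have hv3 : (2 : 𝓞 ℚ) ∈ (w.under (𝓞 ℚ)).asIdeal := by
      rw [← hw, Ideal.under_def, Ideal.mem_comap, map_ofNat]; exact hw3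
    obtain ⟨hσv, t, d, hP, ht0, ht4d⟩ := h2g _ hv3
    have hf : w.asIdeal.inertiaDeg (𝓞 ℚ) = 1 := (h2split w hw3).1
    -- split the Frobenius polynomial over `ℂ`
    obtain ⟨s, hs⟩ := IsAlgClosed.exists_eq_mul_self (t ^ 2 - 4 * d)
    set a : ℂ := (t + s) / 2 with ha
    set b : ℂ := (t - s) / 2 with hb
    have hab_sum : a + b = t := by rw [ha, hb]; ring
    have hab_prod : a * b = d := by
      have h1 : a * b = (t ^ 2 - s * s) / 4 := by rw [ha, hb]; ring
      rw [h1, ← hs]; ring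
    have hPab : (X ^ 2 - C t * X + C d : ℂ[X]) = (X - C a) * (X - C b) := by
      rw [← hab_sum, ← hab_prod, C_add, C_mul]; ring
    have hP' : σ.HasFrobCharpolyAt (w.under (𝓞 ℚ)) ((X - C a) * (X - C b)) := hPab ▸ hP
    have hab : a ≠ b := by
      intro h
      apply ht4d
      have h1 : t ^ 2 - 4 * d = (a - b) ^ 2 := by rw [← hab_sum, ← hab_prod]; ring
      rw [← sub_eq_zero, h1, h, sub_self, zero_pow two_ne_zero]
    have h2ab : a + b ≠ 0 := by rw [hab_sum]; exact ht0
    -- a Frobenius element at `v ∣ 2` and its matrix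
    obtain ⟨𝔓, h𝔓⟩ := (w.under (𝓞 ℚ)).primesAbove_nonempty
    obtain ⟨g0, hg0⟩ := IsDedekindDomain.HeightOneSpectrum.exists_isArithFrobAt_of_mem_primesAbove_holds h𝔓
    have hch : ((σ g0 : GL (Fin 2) ℂ) : Matrix (Fin 2) (Fin 2) ℂ).charpoly = (X - C a) * (X - C b) :=
      hP' 𝔓 h𝔓 g0 hg0
    -- finite order of `σ g0`
    haveI hfinσ : Finite σ.toMonoidHom.range := finite_range_toMonoidHom (F := ℚ) (n := 2) σ
    have hn0 : Nat.card σ.toMonoidHom.range ≠ 0 := Nat.card_pos.ne'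
    have hgn : (σ g0) ^ Nat.card σ.toMonoidHom.range = 1 := by
      have h1 := pow_card_eq_one' (G := σ.toMonoidHom.range) (x := ⟨σ g0, MonoidHom.mem_range.2 ⟨g0, rfl⟩⟩)
      have h2 := congrArg Subtype.val h1
      rwa [Subgroup.coe_pow, Subgroup.coe_one] at h2
    have hAn : ((σ g0 : GL (Fin 2) ℂ) : Matrix (Fin 2) (Fin 2) ℂ) ^ Nat.card σ.toMonoidHom.range = (1 : ℂ) • 1 := by
      rw [one_smul, ← Units.val_pow_eq_pow_val, hgn, Units.val_one]
    have han : a ^ Nat.card σ.toMonoidHom.range = 1 := eig_pow_eq hch hab hAn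
    have hbn : b ^ Nat.card σ.toMonoidHom.range = 1 := eig_pow_eq' hch hab hAn
    -- projective order divides the exponent `30` of `A₅`: `(σ g0) ^ 30` is central, hence scalar
    have h60 : (Matrix.ProjGenLinGroup.mk (σ g0)) ^ 30 = 1 := by
      have hmem : Matrix.ProjGenLinGroup.mk (σ g0) ∈ (Matrix.ProjGenLinGroup.mk.comp σ.toMonoidHom).range :=
        MonoidHom.mem_range.2 ⟨g0, rfl⟩
      have h1 : (⟨_, hmem⟩ : (Matrix.ProjGenLinGroup.mk.comp σ.toMonoidHom).range) ^ 30 = 1 :=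
        e.injective (by rw [map_pow, map_one]; exact alternatingGroup_five_pow_thirty _)
      have h2 := congrArg Subtype.val h1
      rwa [Subgroup.coe_pow, Subgroup.coe_one] at h2
    have hcen : (σ g0) ^ 30 ∈ Subgroup.center (GL (Fin 2) ℂ) := by
      rw [← Matrix.ProjGenLinGroup.mk_eq_one, map_pow]; exact h60
    obtain ⟨c, hc⟩ := Matrix.GeneralLinearGroup.mem_center_iff_val_mem_range_scalar.1 hcen
    have hA60 : ((σ g0 : GL (Fin 2) ℂ) : Matrix (Fin 2) (Fin 2) ℂ) ^ 30 = c • 1 := by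
      rw [← Units.val_pow_eq_pow_val, ← hc, Matrix.scalar_apply, ← Matrix.smul_one_eq_diagonal]
    have ha60 : a ^ 30 = c := eig_pow_eq hch hab hA60
    have hb60 : b ^ 30 = c := eig_pow_eq' hch hab hA60
    -- restriction to `M` (`f = 1`) and `2`-adic transport of the Frobenius polynomial
    have hPτ : (FramedGaloisRep.restrictField M σ).HasFrobCharpolyAt w ((X - C a) * (X - C b)) := by
      have h1 := FramedGaloisRep.hasFrobCharpolyAt_restrictField_fin_two (E := M) σ hw hσv hP'
      rwa [hf, pow_one, pow_one] at h1
    have hPτ₃ : τ₃.HasFrobCharpolyAt w (((X - C a) * (X - C b)).map φ) :=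
      hchar_map hPτ
    have hmapP : (((X - C a) * (X - C b) : ℂ[X])).map φ = X ^ 2 - C (φ a + φ b) * X + C (φ a * φ b) := by
      simp only [Polynomial.map_mul, Polynomial.map_sub, Polynomial.map_X, Polynomial.map_C, C_add, C_mul]
      ring
    rw [hmapP] at hPτ₃
    refine ⟨hunr_map
        (FramedGaloisRep.isUnramifiedAt_restrictField σ hw hσv), φ a + φ b, φ a * φ b, hPτ₃, ?_⟩
    -- the norm
    have hsq : (φ a + φ b) ^ 2 - 4 * (φ a * φ b) = (φ a - φ b) ^ 2 := by ring
    have h2ab' : φ a + φ b ≠ 0 := by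
      rw [← map_add]
      exact (map_ne_zero φ).2 h2ab
    rw [hsq, norm_pow, norm_sub_eq_one_of_rootsOfUnity_two hn0 (by rw [← map_pow, han, map_one])
      (by rw [← map_pow, hbn, map_one]) (by rw [← map_pow, ← map_pow, ha60, hb60])
      (fun h => hab (φ.injective h)) h2ab', one_pow]


/-! ## RM₂ — the door at the residual prime `2` (stub, ATTACKABLE print chain; quadratic members) -/


/-! ## Composition -/

/-- **`CofinalResidualDoorTwo` from three layer statements** (general-member RM₂), concluding the crux decl BY NAME.
Bookkeeping: a.e. unramifiedness of `σ`, then T1₂ → T2₂ → RM₂ at each good `p`, then re-tupling. [folklore] -/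
theorem CofinalResidualDoorTwo_of
    (h1 : ∀ p : IsDedekindDomain.HeightOneSpectrum (NumberField.RingOfIntegers ℚ), ∃ (M : Type) (_ : Field M) (_ : NumberField M), FieldClausesTwo p M ∧ TwoSplit M)
    (h2 : ∀ (ι : PadicAlgCl 2 ≃+* ℂ) (σ : Literature.NumberTheory.GaloisRepresentations.FramedGaloisRep ℚ ℂ 2), Nonempty ((Matrix.ProjGenLinGroup.mk.comp σ.toMonoidHom).range ≃* alternatingGroup (Fin 5)) → (∀ v : IsDedekindDomain.HeightOneSpectrum (NumberField.RingOfIntegers ℚ), (2 : NumberField.RingOfIntegers ℚ) ∈ v.asIdeal → σ.IsUnramifiedAt v ∧ ∃ t d : ℂ, σ.HasFrobCharpolyAt v (Polynomial.X ^ 2 - Polynomial.C t * Polynomial.X + Polynomial.C d) ∧ t ≠ 0 ∧ t ^ 2 ≠ 4 * d) → ∀ p : IsDedekindDomain.HeightOneSpectrum (NumberField.RingOfIntegers ℚ), σ.IsUnramifiedAt p → ∀ (M : Type) [Field M] [NumberField M], FieldClausesTwo p M → TwoSplit M → ∃ (χ : Literature.NumberTheory.GaloisRepresentations.FramedGaloisRep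 M ℂ 1) (τ : Literature.NumberTheory.GaloisRepresentations.FramedGaloisRep M ℂ 2) (τ₂ : Literature.NumberTheory.GaloisRepresentations.FramedGaloisRep M (PadicAlgCl 2) 2), GaloisClausesTwo ι σ p M χ τ τ₂)
    (h3 : ∀ (p : IsDedekindDomain.HeightOneSpectrum (NumberField.RingOfIntegers ℚ)) (M : Type) [Field M] [NumberField M], FieldClausesTwo p M → TwoSplit M → ∀ τ₂ : Literature.NumberTheory.GaloisRepresentations.FramedGaloisRep M (PadicAlgCl 2) 2, Finite τ₂.toMonoidHom.range → Nonempty ((Matrix.ProjGenLinGroup.mk.comp τ₂.toMonoidHom).range ≃* alternatingGroup (Fin 5)) → (∀ w : IsDedekindDomain.HeightOneSpectrum (NumberField.RingOfIntegers M), (2 : NumberField.RingOfIntegers M) ∈ w.asIdeal → τ₂.IsUnramifiedAt w ∧ ∃ t d : PadicAlgCl 2, τ₂.HasFrobCharpolyAt w (Polynomial.X ^ 2 - Polynomial.C t * Polynomial.X + Polynomial.C d) ∧ ‖t ^ 2 - 4 * d‖ = 1) → ResClauseTwo M τ₂) :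
    CofinalResidualDoorTwo := by
  intro ι σ hirr hico heven hdist
  have hunr : ∀ᶠ p : IsDedekindDomain.HeightOneSpectrum (NumberField.RingOfIntegers ℚ) in Filter.cofinite, σ.IsUnramifiedAt p :=
    FramedArtinRep.eventually_isUnramifiedAt σ
  filter_upwards [hunr] with p hp
  obtain ⟨M, iF, iNF, hF, h2s⟩ := h1 p
  obtain ⟨χ, τ, τ₂, hG⟩ := @h2 ι σ hico hdist p hp M iF iNF hF h2s
  obtain ⟨g1, g2, g3, g4, g5, g6⟩ := hG
  obtain ⟨𝒰, hU⟩ := @h3 p M iF iNF hF h2s τ₂ g3 g5 g6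
  obtain ⟨f1, f2, f3, f4, f5, f6, f7⟩ := hF
  exact ⟨M, iF, iNF, f1, f2, f3, f4, f5, f6, f7, χ, τ, τ₂, g1, g2, g3, g4, g5, g6, 𝒰, hU⟩

/-- **`CofinalResidualDoorTwo` through the QUADRATIC door** (T1₂ proved; RM₂ only for `[M : ℚ] = 2`). [folklore] -/
theorem CofinalResidualDoorTwo_of_quadraticDoor
    (h2 : ∀ (ι : PadicAlgCl 2 ≃+* ℂ) (σ : Literature.NumberTheory.GaloisRepresentations.FramedGaloisRep ℚ ℂ 2), Nonempty ((Matrix.ProjGenLinGroup.mk.comp σ.toMonoidHom).range ≃* alternatingGroup (Fin 5)) → (∀ v : IsDedekindDomain.HeightOneSpectrum (NumberField.RingOfIntegers ℚ), (2 : NumberField.RingOfIntegers ℚ) ∈ v.asIdeal → σ.IsUnramifiedAt v ∧ ∃ t d : ℂ, σ.HasFrobCharpolyAt v (Polynomial.X ^ 2 - Polynomial.C t * Polynomial.X + Polynomial.C d) ∧ t ≠ 0 ∧ t ^ 2 ≠ 4 * d) → ∀ p : IsDedekindDomain.HeightOneSpectrum (NumberField.RingOfIntegers ℚ), σ.IsUnramifiedAt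 p → ∀ (M : Type) [Field M] [NumberField M], FieldClausesTwo p M → TwoSplit M → ∃ (χ : Literature.NumberTheory.GaloisRepresentations.FramedGaloisRep M ℂ 1) (τ : Literature.NumberTheory.GaloisRepresentations.FramedGaloisRep M ℂ 2) (τ₂ : Literature.NumberTheory.GaloisRepresentations.FramedGaloisRep M (PadicAlgCl 2) 2), GaloisClausesTwo ι σ p M χ τ τ₂)
    (h3 : ∀ (p : IsDedekindDomain.HeightOneSpectrum (NumberField.RingOfIntegers ℚ)) (M : Type) [Field M] [NumberField M], FieldClausesTwo p M → TwoSplit M → Module.finrank ℚ M = 2 → ∀ τ₂ : Literature.NumberTheory.GaloisRepresentations.FramedGaloisRep M (PadicAlgCl 2) 2, Finite τ₂.toMonoidHom.range → Nonempty ((Matrix.ProjGenLinGroup.mk.comp τ₂.toMonoidHom).range ≃* alternatingGroup (Fin 5)) → (∀ w : IsDedekindDomain.HeightOneSpectrum (NumberField.RingOfIntegers M), (2 : NumberField.RingOfIntegers M) ∈ w.asIdeal → τ₂.IsUnramifiedAt w ∧ ∃ t d : PadicAlgCl 2, τ₂.HasFrobCharpolyAt w (Polynomial.X ^ 2 - Polynomial.C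 t * Polynomial.X + Polynomial.C d) ∧ ‖t ^ 2 - 4 * d‖ = 1) → ResClauseTwo M τ₂) :
    CofinalResidualDoorTwo := by
  intro ι σ hirr hico heven hdist
  have hunr : ∀ᶠ p : IsDedekindDomain.HeightOneSpectrum (NumberField.RingOfIntegers ℚ) in Filter.cofinite, σ.IsUnramifiedAt p :=
    FramedArtinRep.eventually_isUnramifiedAt σ
  filter_upwards [hunr] with p hp
  obtain ⟨M, iF, iNF, hF, h2s, hdeg⟩ := fieldSupplyTwo_quadratic p
  obtain ⟨χ, τ, τ₂, hG⟩ := @h2 ι σ hico hdist p hp M iF iNF hF h2s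
  obtain ⟨g1, g2, g3, g4, g5, g6⟩ := hG
  obtain ⟨𝒰, hU⟩ := @h3 p M iF iNF hF h2s hdeg τ₂ g3 g5 g6
  obtain ⟨f1, f2, f3, f4, f5, f6, f7⟩ := hF
  exact ⟨M, iF, iNF, f1, f2, f3, f4, f5, f6, f7, χ, τ, τ₂, g1, g2, g3, g4, g5, g6, 𝒰, hU⟩

end Summit.Langlands.Langlands.Theorems.SplitPrimeDescentLadder.V4Birth.CofinalResidualDoorTwo

end
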